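import Summits.AnomalousDissipation.AnomalousDissipation.Theorems.MomentParityQuarticGateTransport
import Summits.AnomalousDissipation.AnomalousDissipation.Theorems.QuarticGate.Negative.LevelCeiling
import Literature.Analysis.FluidPDE.CylindricalGenerator
import Literature.Analysis.FluidPDE.StatisticalSolutionEnergyEq
import Literature.Analysis.FluidPDE.OnsagerBDSVBiotSavart
import Literature.Analysis.FluidPDE.BeltramiWavesCurl

/-!
# Order-3 surgery for `MomentParity.QuarticGate` (stmt-AnomalousDissipation-11464), helper V:
# rows of polynomial tests in a band basis ("Rows")

Support file for the stub `stub_order3Surgery` of the line `recession-cone` (S5), torus side, in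
the vocabulary of `Theorems/QuarticGate/Negative/LevelCeiling.lean` (`IsLevel`, `IsBandTest`,
`polyGrad`; definitional unfoldings of the crux clauses). For a family `b` of band tests:

* `polyGrad_transport`, `eval_pairing_transport` — a test `(g, P)` with `gⱼ = Σᵢ Gⱼᵢ bᵢ`
  has the same observable and the same differential field as `(b, P ∘ G)` (Transport);
* `polyGrad_sum_smul`, `nsGeneratorPairing_polyGrad_sum_smul` — the row integrand
  `u ↦ ⟨F(u), ∇p(u)⟩` is linear in `P`;
* `integrable_eval_coords`, `integral_eval_coords_eq_rieszFunctional` — for a law with bounded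
  support, coordinate polynomials are integrable and their means are the Riesz functional of the
  coordinate moment sequence;
* `rieszFunctional_lt_of_nondegenerate` — the nondegenerate-covariance clause of the stub is
  positive definiteness of that sequence in the sense of `Fatten`;
* `rieszFunctional_eq_zero_of_homogeneousComponent_eq_zero` — **the kernel step**: if the row
  polynomial `Q` of a homogeneous quadratic test has no cubic part, then its Euler derivative
  vanishes on level-`N` fields, QuadRigidity makes `∇p = 2αP_N u + 2β curl P_N u`, and the row of
  ANY sequence agreeing with the law's moments up to degree `2` is `2α·(energy row) + 2β·(helicity
  row) = 0`.
-/

-- `Summit.<Summit>.<Problem>` is the tree's mandated summit-side namespace (CONVENTIONS §2); for this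
-- single-conjunct summit the two coincide, so the duplicate is deliberate.
set_option linter.dupNamespace false

namespace Summit.AnomalousDissipation.AnomalousDissipation.Theorems.MomentParityQuarticGate

open scoped BigOperators InnerProductSpace RealInnerProductSpace ENNReal
open MeasureTheory MvPolynomial Literature.MeasureTheory.Moments
open Literature.Analysis.FunctionSpaces Literature.Analysis.FluidPDE
open Summit.AnomalousDissipation.AnomalousDissipation.Theorems.QuarticGate.Negative

/-! ## Transport and linearity of the differential field -/

/-- **Transport of `∇p`.** If `gⱼ = Σᵢ Gⱼᵢ bᵢ` pointwise and the pairings transform accordingly,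
the differential field of `(g, P)` is that of `(b, P ∘ G)`. [folklore] -/
theorem polyGrad_transport :
    ∀ {n m : ℕ} {b : Fin n → UnitAddTorus (Fin 3) → EuclideanSpace ℝ (Fin 3)} {g : Fin m →
      UnitAddTorus (Fin 3) → EuclideanSpace ℝ (Fin 3)} (G : Fin m → Fin n → ℝ), (∀ j x, g j x = ∑ i,
      G j i • b i x) → (∀ (u : Torus.energySpace (Fin 3)) (j : Fin m), Torus.pairing u.1 (g j) =
      ∑ i, G j i * Torus.pairing u.1 (b i)) → ∀ (P : MvPolynomial (Fin m) ℝ) (u :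
      Torus.energySpace (Fin 3)) (x : UnitAddTorus (Fin 3)), polyGrad g P u x = polyGrad b
      (MvPolynomial.bind₁ (fun j => ∑ i, MvPolynomial.C (G j i) * (MvPolynomial.X i :
      MvPolynomial (Fin n) ℝ)) P) u x := by
  intro n m b g G hgb hpair P u x
  unfold polyGrad
  rw [show (fun j => Torus.pairing u.1 (g j)) = fun j => ∑ i, G j i * Torus.pairing u.1 (b i) from
    funext (hpair u)]
  exact sum_eval_pderiv_smul_eq_of_eq_sum G (fun j => g j x) (fun i => b i x) (fun j => hgb j x) _ P

/-- **Transport of `p`.** The observable of `(g, P)` is that of `(b, P ∘ G)`. [folklore] -/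
theorem eval_pairing_transport {n m : ℕ}
    {b : Fin n → UnitAddTorus (Fin 3) → EuclideanSpace ℝ (Fin 3)}
    {g : Fin m → UnitAddTorus (Fin 3) → EuclideanSpace ℝ (Fin 3)} (G : Fin m → Fin n → ℝ)
    (hpair : ∀ (u : Torus.energySpace (Fin 3)) (j : Fin m),
      Torus.pairing u.1 (g j) = ∑ i, G j i * Torus.pairing u.1 (b i))
    (P : MvPolynomial (Fin m) ℝ) (u : Torus.energySpace (Fin 3)) :
    eval (fun j => Torus.pairing u.1 (g j)) P =
      eval (fun i => Torus.pairing u.1 (b i))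
        (bind₁ (fun j => ∑ i, C (G j i) * (X i : MvPolynomial (Fin n) ℝ)) P) :=
  eval_eq_eval_bind₁_of_eq_sum G _ _ (hpair u) P

/-- `∇` is linear in `P`. [folklore] -/
theorem polyGrad_sum_smul {m : ℕ} (g : Fin m → UnitAddTorus (Fin 3) → EuclideanSpace ℝ (Fin 3))
    {ι : Type*} (s : Finset ι) (w : ι → ℝ) (P : ι → MvPolynomial (Fin m) ℝ)
    (u : Torus.energySpace (Fin 3)) (x : UnitAddTorus (Fin 3)) :
    polyGrad g (∑ a ∈ s, w a • P a) u x = ∑ a ∈ s, w a • polyGrad g (P a) u x :=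
  sum_eval_pderiv_sum_smul s w P _ _

/-- The differential field of a polynomial test with smooth test fields is smooth. [folklore] -/
theorem isSmooth_polyGrad {m : ℕ} {g : Fin m → UnitAddTorus (Fin 3) → EuclideanSpace ℝ (Fin 3)}
    (hg : ∀ j, Torus.IsSmooth (g j)) (P : MvPolynomial (Fin m) ℝ) (u : Torus.energySpace (Fin 3)) :
    Torus.IsSmooth (polyGrad g P u) :=
  Torus.isSmooth_sum_smul _ _ fun j _ => hg j

/-- **The row integrand is linear in `P`**: `⟨F(u), ∇(Σₐ wₐ pₐ)(u)⟩ = Σₐ wₐ ⟨F(u), ∇pₐ(u)⟩`.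
[folklore] -/
theorem nsGeneratorPairing_polyGrad_sum_smul (ν : ℝ) {f : UnitAddTorus (Fin 3) → EuclideanSpace ℝ (Fin 3)}
    (hf : Torus.IsSmooth f) {m : ℕ} {g : Fin m → UnitAddTorus (Fin 3) → EuclideanSpace ℝ (Fin 3)}
    (hg : ∀ j, Torus.IsSmooth (g j)) {ι : Type*} (s : Finset ι) (w : ι → ℝ)
    (P : ι → MvPolynomial (Fin m) ℝ) (u : Torus.energySpace (Fin 3)) :
    Torus.nsGeneratorPairing ν f u (polyGrad g (∑ a ∈ s, w a • P a) u) =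
      ∑ a ∈ s, w a * Torus.nsGeneratorPairing ν f u (polyGrad g (P a) u) := by
  rw [show polyGrad g (∑ a ∈ s, w a • P a) u = fun x => ∑ a ∈ s, w a • polyGrad g (P a) u x from
    funext (polyGrad_sum_smul g s w P u)]
  exact Torus.nsGeneratorPairing_sum_smul ν hf.integrable u s w fun a _ => isSmooth_polyGrad hg (P a) u

/-! ## Coordinate moments of a law with bounded support -/

/-- For a finite law on `H` with bounded support, every polynomial in the pairings with finitely
many `L²` test fields is integrable. [folklore] -/
theorem integrable_eval_coords {n : ℕ} {b : Fin n → UnitAddTorus (Fin 3) → EuclideanSpace ℝ (Fin 3)}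
    (hb : ∀ i, MemLp (b i) 2 volume) (μ : Measure (Torus.energySpace (Fin 3))) [IsFiniteMeasure μ]
    {R : ℝ} (hR : ∀ᵐ u ∂μ, ‖u‖ ≤ R) (Q : MvPolynomial (Fin n) ℝ) :
    Integrable (fun u : Torus.energySpace (Fin 3) => eval (fun i => Torus.pairing u.1 (b i)) Q) μ := by
  -- push forward to `ℝⁿ`, where the law is carried by a compact box
  set Φ : Torus.energySpace (Fin 3) → (Fin n → ℝ) := fun u i => Torus.pairing u.1 (b i) with hΦ
  have hΦc : Continuous Φ := continuous_pi fun i => Torus.continuous_pairing_coe (hb i)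
  set K : Fin n → ℝ := fun i => ‖(hb i).toLp (b i)‖ * |R| with hK
  have hbox : ∀ᵐ u ∂μ, Φ u ∈ Set.Icc (-K) K := by
    filter_upwards [hR] with u hu
    have hu' : ‖u‖ ≤ |R| := hu.trans (le_abs_self R)
    constructor <;> intro i
    · have h := (abs_le.mp ((Torus.abs_pairing_coe_le (hb i) u).trans
        (by nlinarith [norm_nonneg u, norm_nonneg ((hb i).toLp (b i))] :
          ‖u‖ * ‖(hb i).toLp (b i)‖ ≤ ‖(hb i).toLp (b i)‖ * |R|))).1
      simpa [hK] using h
    · have h := (abs_le.mp ((Torus.abs_pairing_coe_le (hb i) u).trans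
        (by nlinarith [norm_nonneg u, norm_nonneg ((hb i).toLp (b i))] :
          ‖u‖ * ‖(hb i).toLp (b i)‖ ≤ ‖(hb i).toLp (b i)‖ * |R|))).2
      simpa [hK] using h
  obtain ⟨C, hC⟩ := (isCompact_Icc : IsCompact (Set.Icc (-K) K)).exists_bound_of_continuousOn
    (MvPolynomial.continuous_eval Q).continuousOn
  refine Integrable.of_bound ((MvPolynomial.continuous_eval Q).comp hΦc).aestronglyMeasurable C ?_
  filter_upwards [hbox] with u hu
  exact hC _ hu

/-- **Means of coordinate polynomials are the Riesz functional of the coordinate moments** (law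
with bounded support). [folklore] -/
theorem integral_eval_coords_eq_rieszFunctional {n : ℕ}
    {b : Fin n → UnitAddTorus (Fin 3) → EuclideanSpace ℝ (Fin 3)}
    (hb : ∀ i, MemLp (b i) 2 volume) (μ : Measure (Torus.energySpace (Fin 3))) [IsFiniteMeasure μ]
    {R : ℝ} (hR : ∀ᵐ u ∂μ, ‖u‖ ≤ R) (Q : MvPolynomial (Fin n) ℝ) :
    ∫ u, eval (fun i => Torus.pairing u.1 (b i)) Q ∂μ =
      rieszFunctional (fun α => ∫ u, ∏ i, (Torus.pairing u.1 (b i)) ^ α i ∂μ) Q := by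
  unfold rieszFunctional
  have hmono : ∀ α : Fin n →₀ ℕ, Integrable
      (fun u : Torus.energySpace (Fin 3) => ∏ i, (Torus.pairing u.1 (b i)) ^ α i) μ := fun α => by
    have h := integrable_eval_coords hb μ hR (monomial α 1)
    simp_rw [eval_monomial, one_mul, Finsupp.prod_fintype _ _ fun j => pow_zero _] at h
    exact h
  simp_rw [eval_eq']
  rw [integral_finsetSum _ fun α _ => (hmono α).const_mul _]
  simp_rw [integral_const_mul]

/-! ## Nondegenerate covariance = positive definiteness of the coordinate moments -/

/-- The nondegenerate-covariance clause of the stub, read in a band basis: the coordinate moment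
sequence has `L((ξ·X)²) > L(ξ·X)²` for `ξ ≠ 0`. [folklore] -/
theorem rieszFunctional_lt_of_nondegenerate {N n : ℕ}
    {b : Fin n → UnitAddTorus (Fin 3) → EuclideanSpace ℝ (Fin 3)}
    (μ : Measure (Torus.energySpace (Fin 3))) (y : (Fin n →₀ ℕ) → ℝ)
    (hmom : ∀ Q : MvPolynomial (Fin n) ℝ,
      ∫ u, eval (fun i => Torus.pairing u.1 (b i)) Q ∂μ = rieszFunctional y Q)
    (hband : ∀ ξ : Fin n → ℝ, IsBandTest N (fun x => ∑ i, ξ i • b i x))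
    (hlin : ∀ (u : Torus.energySpace (Fin 3)) (ξ : Fin n → ℝ),
      Torus.pairing u.1 (fun x => ∑ i, ξ i • b i x) = ∑ i, ξ i * Torus.pairing u.1 (b i))
    (hlev : ∀ x : Fin n → ℝ, ∃ u : Torus.energySpace (Fin 3), IsLevel N u ∧
      (fun i => Torus.pairing u.1 (b i)) = x)
    (hnd : ∀ g : UnitAddTorus (Fin 3) → EuclideanSpace ℝ (Fin 3), IsBandTest N g →
      (∃ u : Torus.energySpace (Fin 3), IsLevel N u ∧ Torus.pairing u.1 g ≠ 0) →
      (∫ u, Torus.pairing u.1 g ∂μ) ^ 2 < ∫ u, (Torus.pairing u.1 g) ^ 2 ∂μ)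
    (ξ : Fin n → ℝ) (hξ : ξ ≠ 0) :
    (rieszFunctional y (∑ i, ξ i • X i)) ^ 2 < rieszFunctional y ((∑ i, ξ i • X i) ^ 2) := by
  have heval : ∀ u : Torus.energySpace (Fin 3),
      eval (fun i => Torus.pairing u.1 (b i)) (∑ i, ξ i • (X i : MvPolynomial (Fin n) ℝ)) =
        Torus.pairing u.1 (fun x => ∑ i, ξ i • b i x) := fun u => by
    rw [hlin, map_sum]
    simp [smul_eval]
  have hex : ∃ u : Torus.energySpace (Fin 3), IsLevel N u ∧
      Torus.pairing u.1 (fun x => ∑ i, ξ i • b i x) ≠ 0 := by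
    obtain ⟨u, hu, hux⟩ := hlev ξ
    refine ⟨u, hu, ?_⟩
    rw [hlin]
    have hpos : 0 < ∑ i, ξ i * ξ i := by
      obtain ⟨i, hi⟩ : ∃ i, ξ i ≠ 0 := by
        by_contra hall
        push Not at hall
        exact hξ (funext hall)
      exact lt_of_lt_of_le (mul_self_pos.mpr hi)
        (Finset.single_le_sum (fun j _ => mul_self_nonneg (ξ j)) (Finset.mem_univ i))
    have hx : ∀ i, Torus.pairing u.1 (b i) = ξ i := fun i => congr_fun hux i
    simp_rw [hx]
    exact hpos.ne'
  have key := hnd _ (hband ξ) hex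
  rw [← hmom, ← hmom]
  simp_rw [map_pow, heval]
  exact key

/-! ## The kernel step: quadratic Casimirs have vanishing rows -/

/-- **Kernel step of the order-3 surgery.** Let `Q` (degree `≤ 3`) be the row polynomial of a
homogeneous quadratic test `P` over a family `b` of band tests, with cubic part evaluating to the
Euler derivative `{p, B_N}`. If that cubic part is ZERO, QuadRigidity gives
`∇p(u) = 2α P_N u + 2β curl P_N u` on level-`N` fields, so the row integrand is
`2α⟨F(u), P_N u⟩ + 2β⟨F(u), curl P_N u⟩`; hence for a level-`N` law `μ₀` with bounded support whose
energy and helicity rows vanish, `L_y(Q) = 0` for EVERY sequence `y` that agrees with the coordinate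
moments of `μ₀` up to degree `2`. [folklore] -/
theorem rieszFunctional_eq_zero_of_homogeneousComponent_eq_zero {N n : ℕ}
    {b : Fin n → UnitAddTorus (Fin 3) → EuclideanSpace ℝ (Fin 3)}
    (ν : ℝ) {f : UnitAddTorus (Fin 3) → EuclideanSpace ℝ (Fin 3)} (hf : Torus.IsSmooth f)
    (μ₀ : Measure (Torus.energySpace (Fin 3))) (hl₀ : ∀ᵐ u ∂μ₀, IsLevel N u)
    (y₀ y : (Fin n →₀ ℕ) → ℝ)
    (hmom : ∀ Q : MvPolynomial (Fin n) ℝ,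
      Integrable (fun u : Torus.energySpace (Fin 3) => eval (fun i => Torus.pairing u.1 (b i)) Q) μ₀ ∧
      ∫ u, eval (fun i => Torus.pairing u.1 (b i)) Q ∂μ₀ = rieszFunctional y₀ Q)
    (hy : ∀ α : Fin n →₀ ℕ, α.degree + 1 ≤ 3 → y α = y₀ α)
    (hE : Integrable (fun u : Torus.energySpace (Fin 3) => Torus.nsGeneratorPairing ν f u
        (Torus.fourierTruncate N (u.1 : UnitAddTorus (Fin 3) → EuclideanSpace ℝ (Fin 3)))) μ₀ ∧
      ∫ u, Torus.nsGeneratorPairing ν f u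
        (Torus.fourierTruncate N (u.1 : UnitAddTorus (Fin 3) → EuclideanSpace ℝ (Fin 3))) ∂μ₀ = 0)
    (hH : Integrable (fun u : Torus.energySpace (Fin 3) => Torus.nsGeneratorPairing ν f u
        (BDSV.curl (Torus.fourierTruncate N (u.1 : UnitAddTorus (Fin 3) → EuclideanSpace ℝ (Fin 3))))) μ₀ ∧
      ∫ u, Torus.nsGeneratorPairing ν f u
        (BDSV.curl (Torus.fourierTruncate N (u.1 : UnitAddTorus (Fin 3) → EuclideanSpace ℝ (Fin 3)))) ∂μ₀ = 0)
    (hQuad : ∀ P : MvPolynomial (Fin n) ℝ, P.IsHomogeneous 2 →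
      (∀ u : Torus.energySpace (Fin 3), IsLevel N u →
        Torus.nsGeneratorPairing (d := Fin 3) 0 0 u (polyGrad b P u) = 0) →
      ∃ α β : ℝ, ∀ u : Torus.energySpace (Fin 3), IsLevel N u → ∀ x, polyGrad b P u x =
        (2 * α) • Torus.fourierTruncate N (u.1 : UnitAddTorus (Fin 3) → EuclideanSpace ℝ (Fin 3)) x +
        (2 * β) • BDSV.curl (Torus.fourierTruncate N (u.1 : UnitAddTorus (Fin 3) → EuclideanSpace ℝ (Fin 3))) x)
    (P : MvPolynomial (Fin n) ℝ) (hP : P.IsHomogeneous 2) (Q : MvPolynomial (Fin n) ℝ)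
    (hQ3 : Q.totalDegree ≤ 3)
    (hrow : ∀ u : Torus.energySpace (Fin 3), IsLevel N u →
      Torus.nsGeneratorPairing ν f u (polyGrad b P u) = eval (fun i => Torus.pairing u.1 (b i)) Q)
    (htop : ∀ u : Torus.energySpace (Fin 3), IsLevel N u →
      eval (fun i => Torus.pairing u.1 (b i)) (homogeneousComponent 3 Q) =
        Torus.nsGeneratorPairing (d := Fin 3) 0 0 u (polyGrad b P u))
    (hker : homogeneousComponent 3 Q = 0) :
    rieszFunctional y Q = 0 := by
  -- the Euler derivative vanishes on level-`N` fields, so QuadRigidity applies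
  have heuler : ∀ u : Torus.energySpace (Fin 3), IsLevel N u →
      Torus.nsGeneratorPairing (d := Fin 3) 0 0 u (polyGrad b P u) = 0 := fun u hu => by
    rw [← htop u hu, hker, map_zero]
  obtain ⟨α, β, hαβ⟩ := hQuad P hP heuler
  -- the row integrand is `2α·(energy integrand) + 2β·(helicity integrand)` on level-`N` fields
  have hsplit : ∀ u : Torus.energySpace (Fin 3), IsLevel N u →
      eval (fun i => Torus.pairing u.1 (b i)) Q =
        2 * α * Torus.nsGeneratorPairing ν f u
          (Torus.fourierTruncate N (u.1 : UnitAddTorus (Fin 3) → EuclideanSpace ℝ (Fin 3))) +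
        2 * β * Torus.nsGeneratorPairing ν f u
          (BDSV.curl (Torus.fourierTruncate N (u.1 : UnitAddTorus (Fin 3) → EuclideanSpace ℝ (Fin 3)))) := by
    intro u hu
    set w : Fin 2 → UnitAddTorus (Fin 3) → EuclideanSpace ℝ (Fin 3) :=
      ![Torus.fourierTruncate N (u.1 : UnitAddTorus (Fin 3) → EuclideanSpace ℝ (Fin 3)),
        BDSV.curl (Torus.fourierTruncate N (u.1 : UnitAddTorus (Fin 3) → EuclideanSpace ℝ (Fin 3)))] with hw
    set c : Fin 2 → ℝ := ![2 * α, 2 * β] with hc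
    have hws : ∀ k ∈ (Finset.univ : Finset (Fin 2)), Torus.IsSmooth (w k) := by
      intro k _
      fin_cases k
      · exact Torus.isSmooth_fourierTruncate N _
      · exact BDSV.isSmooth_curl (Torus.isSmooth_fourierTruncate N _)
    have hfield : polyGrad b P u = fun x => ∑ k, c k • w k x := by
      funext x
      rw [hαβ u hu x, Fin.sum_univ_two]
      rfl
    rw [← hrow u hu, hfield, Torus.nsGeneratorPairing_sum_smul ν hf.integrable u _ c hws,
      Fin.sum_univ_two]
    rfl
  -- `L_y(Q) = L_{y₀}(Q)` since `Q` has degree `≤ 2`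
  have hyy : rieszFunctional y Q = rieszFunctional y₀ Q := by
    have h := rieszFunctional_sub_homogeneousComponent_congr (k := 3) hy Q hQ3
    rwa [hker, sub_zero] at h
  rw [hyy, ← (hmom Q).2, integral_congr_ae (hl₀.mono fun u hu => hsplit u hu)]
  rw [integral_add (hE.1.const_mul _) (hH.1.const_mul _), integral_const_mul, integral_const_mul,
    hE.2, hH.2, mul_zero, mul_zero, add_zero]

end Summit.AnomalousDissipation.AnomalousDissipation.Theorems.MomentParityQuarticGate
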